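import Summits.Ventures.GridStability.Models.InverterDVOCNetwork

/-!
# GridStability/Models/InverterDVOCAmplitudeBound — global boundedness of the voltage amplitudes of the dVOC network reduced model (certificate-free, every `N`, ALL initial states)

Cell `gridfusion` (LADDER-GRIDFUSION, apex-line rung G3.c «dVOC network»; seat gridfusion-model-3 (g7);
models/MODEL-3-NOTES.md §1 (P14)/(P16) companions). Third honest-framing theorem of the inverter class:
grid-forming droop ≡ machines have a global FREQUENCY band (`Models/SwingFrequencyBound.lean`), the
grid-following PLL model DIVERGES on explicit half-planes (`Models/InverterPLLDivergence.lean`), and here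
the dispatchable-virtual-oscillator network [cite: SuboticEtAl2021, §VI-C eq. (ss.f.vhat)]
`d/dt v̂ = η (𝒦 v̂ − ℛ(κ) 𝒴 v̂ + η_a Φ(v̂) v̂)` (typed `DvocNetwork.field`, p465594) has globally bounded
AMPLITUDES: the cubic term `η η_a Φ_k(v̂_k) v̂_k`, `Φ_k = 1 − ‖v̂_k‖²/v_k*²`, dominates at infinity.

WHAT IS CERTIFIED (kernel, no certificate, no kit). Let `E(v̂) := Σ_k ‖v̂_k‖²` (`totalSqAmp`),
`c_k := (p_k* cos κ + q_k* sin κ)/v_k*²` (`trackGain`: `v̂_kᵀ K_k v̂_k = c_k ‖v̂_k‖²`, `inner_Kv_self`),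
`A := Σ_{k,j} (|Yre_kj| + |Yim_kj|)` (`admittanceWeight`), `a := η_a + Σ_k |c_k| + A` (`growthRate`),
`S := Σ_k v_k*²`, `L := a S/η_a` (`ampBound`). For `η > 0`, `η_a > 0`, all `v_k* ≠ 0`:
* `half_deriv_totalSqAmp_le`: at every state, `Σ_k v̂_k · f^s_k(v̂) ≤ η (a E − (η_a/S) E²) ≤ −η a (E − L)`
  (network term `|Σ_k v̂_kᵀ R(κ)(𝒴v̂)_k| ≤ A·E` by the Lagrange identity and `2√(r_k r_j) ≤ r_k + r_j`;
  cubic term by Cauchy–Schwarz `E² ≤ S · Σ_k ‖v̂_k‖⁴/v_k*²`; then the tangent-at-the-root bound of the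
  concave logistic `aE − (η_a/S)E²`);
* `totalSqAmp_le`: along every solution on `[0, ∞)`,
  `E(t) ≤ L + (E(0) − L) · e^{−2 η a t}` (Grönwall on `(E − L) e^{2ηa t}`); hence the ball `E ≤ L` is
  positively invariant (`totalSqAmp_le_of_le`) and every motion is ultimately inside any `E ≤ L + ε`.

THREE COLUMNS. CERTIFIED: the inequalities (std axioms). MODELLED: the printed reduced model `f^s_v̂`
(MV-6O: inner loops ideal, quasi-steady-state lines; adequacy = the source's Conditions 4–6), ANY
admittance blocks (Assumption 3 not used — under it the network term is even dissipative). The bound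
`L` is crude (total-sum constants) — a qualitative certified statement «no amplitude blow-up in the
dVOC reduced model», not a performance figure; nothing about synchronisation (the printed almost-global
result, Thm. 6, is NOT claimed) and nothing about a converter or a grid. VALIDATED: nothing.
-/

noncomputable section

open Real Set Filter Topology Finset

namespace Summit.Ventures.GridStability.Models.InverterDVOC.DvocNetwork

variable {N : ℕ} (W : DvocNetwork N)

/-! ## §1 The quantities -/

/-- Squared amplitude of converter `k`: `‖v̂_k‖² = x_k² + y_k²`. -/
def sqAmp (v : State N) (k : Fin N) : ℝ := v.1 k ^ 2 + v.2 k ^ 2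

/-- Total squared amplitude `E(v̂) = Σ_k ‖v̂_k‖²`. -/
def totalSqAmp (v : State N) : ℝ := ∑ k, sqAmp v k

/-- Set-point tracking gain seen by the amplitude: `c_k = (p_k* cos κ + q_k* sin κ)/v_k*²`. -/
def trackGain (k : Fin N) : ℝ := (W.pref k * cos W.κ + W.qref k * sin W.κ) / W.vref k ^ 2

/-- Crude admittance weight `A = Σ_{k,j} (|Yre_kj| + |Yim_kj|)`. -/
def admittanceWeight : ℝ := ∑ k, ∑ j, (|W.Yre k j| + |W.Yim k j|)

/-- Linear growth-rate bound `a = η_a + Σ_k |c_k| + A`. -/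
def growthRate : ℝ := W.ηa + ∑ k, |W.trackGain k| + W.admittanceWeight

/-- `S = Σ_k v_k*²`. -/
def vrefSq : ℝ := ∑ k, W.vref k ^ 2

/-- The absorbing level `L = a S / η_a` of the total squared amplitude. -/
def ampBound : ℝ := W.growthRate * W.vrefSq / W.ηa

/-- The network pairing at converter `k`: `v̂_kᵀ R(κ) (𝒴 v̂)_k`. -/
def netPair (v : State N) (k : Fin N) : ℝ :=
  v.1 k * (cos W.κ * W.netCur₁ v k - sin W.κ * W.netCur₂ v k)
    + v.2 k * (sin W.κ * W.netCur₁ v k + cos W.κ * W.netCur₂ v k)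

/-- `‖v̂_k‖² ≥ 0`. -/
theorem sqAmp_nonneg (v : State N) (k : Fin N) : 0 ≤ sqAmp v k := by
  unfold sqAmp; positivity

/-- `E ≥ 0`. -/
theorem totalSqAmp_nonneg (v : State N) : 0 ≤ totalSqAmp v :=
  sum_nonneg fun k _ => sqAmp_nonneg v k

/-- `‖v̂_k‖² ≤ E`. -/
theorem sqAmp_le_totalSqAmp (v : State N) (k : Fin N) : sqAmp v k ≤ totalSqAmp v :=
  single_le_sum (f := fun k => sqAmp v k) (fun j _ => sqAmp_nonneg v j) (mem_univ k)

/-- `A ≥ 0`. -/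
theorem admittanceWeight_nonneg : 0 ≤ W.admittanceWeight := by
  unfold admittanceWeight; positivity

/-! ## §2 Pointwise identities and bounds -/

/-- `v̂_kᵀ K_k v̂_k = c_k ‖v̂_k‖²` (the rotation/set-point block acts on the amplitude through `c_k`). -/
theorem inner_Kv_self (v : State N) (k : Fin N) :
    v.1 k * (W.unit k).Kv₁ (v.1 k) (v.2 k) + v.2 k * (W.unit k).Kv₂ (v.1 k) (v.2 k)
      = W.trackGain k * sqAmp v k := by
  simp only [Dvoc.Kv₁, Dvoc.Kv₂, unit, trackGain, sqAmp]
  ring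

/-- The amplitude balance at converter `k`:
`v̂_k · f^s_k(v̂) = η (c_k ‖v̂_k‖² − v̂_kᵀR(κ)(𝒴v̂)_k + η_a (‖v̂_k‖² − ‖v̂_k‖⁴/v_k*²))`. -/
theorem inner_field (v : State N) (k : Fin N) :
    v.1 k * W.dv₁ v k + v.2 k * W.dv₂ v k
      = W.η * (W.trackGain k * sqAmp v k - W.netPair v k
          + W.ηa * (sqAmp v k - sqAmp v k ^ 2 / W.vref k ^ 2)) := by
  simp only [dv₁, dv₂, Dvoc.dv₁, Dvoc.dv₂, Dvoc.phi, Dvoc.Kv₁, Dvoc.Kv₂, unit, trackGain, sqAmp,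
    netPair]
  ring

/-- The network pairing as a double sum of bilinear terms:
`v̂_kᵀR(κ)(𝒴v̂)_k = Σ_j [Yre_kj (cos κ P_kj + sin κ Q_kj) + Yim_kj (cos κ Q_kj − sin κ P_kj)]`,
`P_kj = x_k x_j + y_k y_j`, `Q_kj = y_k x_j − x_k y_j`. -/
theorem netPair_eq_sum (v : State N) (k : Fin N) :
    W.netPair v k = ∑ j, (W.Yre k j * (cos W.κ * (v.1 k * v.1 j + v.2 k * v.2 j)
        + sin W.κ * (v.2 k * v.1 j - v.1 k * v.2 j))
      + W.Yim k j * (cos W.κ * (v.2 k * v.1 j - v.1 k * v.2 j)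
        - sin W.κ * (v.1 k * v.1 j + v.2 k * v.2 j))) := by
  simp only [netPair, netCur₁, netCur₂, mul_sum, ← sum_sub_distrib, ← sum_add_distrib]
  exact sum_congr rfl fun j _ => by ring

/-- One bilinear term is bounded by `(|Yre_kj| + |Yim_kj|)(‖v̂_k‖² + ‖v̂_j‖²)/2`
(Lagrange identity `P² + Q² = ‖v̂_k‖²‖v̂_j‖²` and `2√(r_k r_j) ≤ r_k + r_j`). -/
theorem netPair_term_le (v : State N) (k j : Fin N) :
    |W.Yre k j * (cos W.κ * (v.1 k * v.1 j + v.2 k * v.2 j) + sin W.κ * (v.2 k * v.1 j - v.1 k * v.2 j))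
      + W.Yim k j * (cos W.κ * (v.2 k * v.1 j - v.1 k * v.2 j)
        - sin W.κ * (v.1 k * v.1 j + v.2 k * v.2 j))|
      ≤ (|W.Yre k j| + |W.Yim k j|) * ((sqAmp v k + sqAmp v j) / 2) := by
  set P := v.1 k * v.1 j + v.2 k * v.2 j with hP
  set Q := v.2 k * v.1 j - v.1 k * v.2 j with hQ
  have hcs : cos W.κ ^ 2 + sin W.κ ^ 2 = 1 := cos_sq_add_sin_sq W.κ
  have hlag : P ^ 2 + Q ^ 2 = sqAmp v k * sqAmp v j := by
    simp only [hP, hQ, sqAmp]; ring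
  have hm : 0 ≤ (sqAmp v k + sqAmp v j) / 2 := by
    have := sqAmp_nonneg v k; have := sqAmp_nonneg v j; linarith
  have hamgm : sqAmp v k * sqAmp v j ≤ ((sqAmp v k + sqAmp v j) / 2) ^ 2 := by
    nlinarith [sq_nonneg (sqAmp v k - sqAmp v j)]
  have h1 : |cos W.κ * P + sin W.κ * Q| ≤ (sqAmp v k + sqAmp v j) / 2 := by
    refine abs_le_of_sq_le_sq ?_ hm
    have : (cos W.κ * P + sin W.κ * Q) ^ 2 ≤ P ^ 2 + Q ^ 2 := by
      nlinarith [sq_nonneg (cos W.κ * Q - sin W.κ * P), hcs]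
    linarith [hlag]
  have h2 : |cos W.κ * Q - sin W.κ * P| ≤ (sqAmp v k + sqAmp v j) / 2 := by
    refine abs_le_of_sq_le_sq ?_ hm
    have : (cos W.κ * Q - sin W.κ * P) ^ 2 ≤ P ^ 2 + Q ^ 2 := by
      nlinarith [sq_nonneg (cos W.κ * P + sin W.κ * Q), hcs]
    linarith [hlag]
  calc |W.Yre k j * (cos W.κ * P + sin W.κ * Q) + W.Yim k j * (cos W.κ * Q - sin W.κ * P)|
      ≤ |W.Yre k j * (cos W.κ * P + sin W.κ * Q)| + |W.Yim k j * (cos W.κ * Q - sin W.κ * P)| :=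
        abs_add_le _ _
    _ = |W.Yre k j| * |cos W.κ * P + sin W.κ * Q| + |W.Yim k j| * |cos W.κ * Q - sin W.κ * P| := by
        rw [abs_mul, abs_mul]
    _ ≤ |W.Yre k j| * ((sqAmp v k + sqAmp v j) / 2) + |W.Yim k j| * ((sqAmp v k + sqAmp v j) / 2) :=
        add_le_add (mul_le_mul_of_nonneg_left h1 (abs_nonneg _))
          (mul_le_mul_of_nonneg_left h2 (abs_nonneg _))
    _ = (|W.Yre k j| + |W.Yim k j|) * ((sqAmp v k + sqAmp v j) / 2) := by ring

/-- The whole network pairing is bounded by the crude weight: `|Σ_k v̂_kᵀR(κ)(𝒴v̂)_k| ≤ A · E`. -/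
theorem abs_sum_netPair_le (v : State N) : |∑ k, W.netPair v k| ≤ W.admittanceWeight * totalSqAmp v := by
  have hE := totalSqAmp_nonneg v
  calc |∑ k, W.netPair v k| ≤ ∑ k, |W.netPair v k| := abs_sum_le_sum_abs _ _
    _ ≤ ∑ k, ∑ j, (|W.Yre k j| + |W.Yim k j|) * ((sqAmp v k + sqAmp v j) / 2) := by
        refine sum_le_sum fun k _ => ?_
        rw [netPair_eq_sum]
        exact (abs_sum_le_sum_abs _ _).trans (sum_le_sum fun j _ => W.netPair_term_le v k j)
    _ ≤ ∑ k, ∑ j, (|W.Yre k j| + |W.Yim k j|) * totalSqAmp v := by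
        refine sum_le_sum fun k _ => sum_le_sum fun j _ => ?_
        refine mul_le_mul_of_nonneg_left ?_ (by positivity)
        have := sqAmp_le_totalSqAmp v k; have := sqAmp_le_totalSqAmp v j; linarith
    _ = W.admittanceWeight * totalSqAmp v := by
        rw [admittanceWeight, sum_mul]
        exact sum_congr rfl fun k _ => by rw [sum_mul]

/-- Cauchy–Schwarz for the cubic term: `E² ≤ S · Σ_k ‖v̂_k‖⁴/v_k*²` (all `v_k* ≠ 0`). -/
theorem totalSqAmp_sq_le (hv : ∀ k, W.vref k ≠ 0) (v : State N) :
    totalSqAmp v ^ 2 ≤ W.vrefSq * ∑ k, sqAmp v k ^ 2 / W.vref k ^ 2 := by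
  have h := sum_mul_sq_le_sq_mul_sq univ (fun k => W.vref k) (fun k => sqAmp v k / W.vref k)
  have e1 : ∑ k, W.vref k * (sqAmp v k / W.vref k) = totalSqAmp v :=
    sum_congr rfl fun k _ => by field_simp [hv k]
  have e2 : ∑ k, (sqAmp v k / W.vref k) ^ 2 = ∑ k, sqAmp v k ^ 2 / W.vref k ^ 2 :=
    sum_congr rfl fun k _ => by rw [div_pow]
  rw [e1, e2] at h
  exact h

/-- `S > 0` as soon as there is a converter and all `v_k* ≠ 0`. -/
theorem vrefSq_pos [NeZero N] (hv : ∀ k, W.vref k ≠ 0) : 0 < W.vrefSq := by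
  have h0 : 0 < W.vref 0 ^ 2 := by have := hv 0; positivity
  exact lt_of_lt_of_le h0
    (single_le_sum (f := fun k => W.vref k ^ 2) (fun j _ => sq_nonneg _) (mem_univ 0))

/-- `a ≥ η_a` (hence `a > 0` when `η_a > 0`). -/
theorem ηa_le_growthRate : W.ηa ≤ W.growthRate := by
  unfold growthRate
  have h1 : 0 ≤ ∑ k, |W.trackGain k| := sum_nonneg fun k _ => abs_nonneg _
  have h2 := W.admittanceWeight_nonneg
  linarith

/-- **Amplitude balance (every state).** For `η > 0`, `η_a > 0`, all `v_k* ≠ 0` (and `N ≥ 1`):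
`Σ_k v̂_k · f^s_k(v̂) ≤ −η a (E − L)`, i.e. half the derivative of `E` along the flow is bounded by a
linear restoring term towards the level `L = aS/η_a`. -/
theorem half_deriv_totalSqAmp_le [NeZero N] (hη : 0 < W.η) (hηa : 0 < W.ηa)
    (hv : ∀ k, W.vref k ≠ 0) (v : State N) :
    ∑ k, (v.1 k * W.dv₁ v k + v.2 k * W.dv₂ v k)
      ≤ -(W.η * W.growthRate * (totalSqAmp v - W.ampBound)) := by
  have hS := W.vrefSq_pos hv
  set E := totalSqAmp v with hE
  have hE0 : 0 ≤ E := totalSqAmp_nonneg v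
  -- rewrite the sum through the per-converter identity
  have hsum : ∑ k, (v.1 k * W.dv₁ v k + v.2 k * W.dv₂ v k)
      = W.η * ((∑ k, W.trackGain k * sqAmp v k) - (∑ k, W.netPair v k)
          + W.ηa * (E - ∑ k, sqAmp v k ^ 2 / W.vref k ^ 2)) := by
    rw [show ∑ k, (v.1 k * W.dv₁ v k + v.2 k * W.dv₂ v k)
        = ∑ k, W.η * (W.trackGain k * sqAmp v k - W.netPair v k
            + W.ηa * (sqAmp v k - sqAmp v k ^ 2 / W.vref k ^ 2)) from
        sum_congr rfl fun k _ => W.inner_field v k]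
    rw [← mul_sum, hE, totalSqAmp]
    congr 1
    simp only [sum_add_distrib, sum_sub_distrib, ← mul_sum]
  -- the three bounds
  have h1 : ∑ k, W.trackGain k * sqAmp v k ≤ (∑ k, |W.trackGain k|) * E := by
    rw [sum_mul]
    refine sum_le_sum fun k _ => ?_
    have hr := sqAmp_nonneg v k
    have hrE : sqAmp v k ≤ E := sqAmp_le_totalSqAmp v k
    calc W.trackGain k * sqAmp v k ≤ |W.trackGain k| * sqAmp v k :=
          mul_le_mul_of_nonneg_right (le_abs_self _) hr
      _ ≤ |W.trackGain k| * E := mul_le_mul_of_nonneg_left hrE (abs_nonneg _)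
  have h2 : -(∑ k, W.netPair v k) ≤ W.admittanceWeight * E := by
    have := W.abs_sum_netPair_le v
    have := neg_abs_le (∑ k, W.netPair v k)
    linarith
  have h3 : E ^ 2 / W.vrefSq ≤ ∑ k, sqAmp v k ^ 2 / W.vref k ^ 2 := by
    rw [div_le_iff₀ hS]
    have := W.totalSqAmp_sq_le hv v
    linarith [mul_comm W.vrefSq (∑ k, sqAmp v k ^ 2 / W.vref k ^ 2)]
  -- logistic bound and tangent at the root
  have hinner : (∑ k, W.trackGain k * sqAmp v k) - (∑ k, W.netPair v k)
        + W.ηa * (E - ∑ k, sqAmp v k ^ 2 / W.vref k ^ 2)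
      ≤ W.growthRate * E - W.ηa / W.vrefSq * E ^ 2 := by
    have h3' : W.ηa * (∑ k, sqAmp v k ^ 2 / W.vref k ^ 2) ≥ W.ηa * (E ^ 2 / W.vrefSq) :=
      mul_le_mul_of_nonneg_left h3 hηa.le
    have : W.ηa / W.vrefSq * E ^ 2 = W.ηa * (E ^ 2 / W.vrefSq) := by ring
    rw [this, growthRate]
    nlinarith
  have htan : W.growthRate * E - W.ηa / W.vrefSq * E ^ 2
      ≤ -(W.growthRate * (E - W.ampBound)) := by
    have hsq : 0 ≤ W.ηa / W.vrefSq * (E - W.ampBound) ^ 2 := by positivity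
    have hid : -(W.growthRate * (E - W.ampBound)) - (W.growthRate * E - W.ηa / W.vrefSq * E ^ 2)
        = W.ηa / W.vrefSq * (E - W.ampBound) ^ 2 := by
      unfold ampBound
      field_simp
      ring
    linarith
  rw [hsum]
  have hη' := hη.le
  have := mul_le_mul_of_nonneg_left (hinner.trans htan) hη'
  linarith

/-! ## §3 Along solutions: the exponential amplitude bound -/

variable {W}

/-- Derivative of the total squared amplitude along a solution (within the time set). -/
theorem hasDerivWithinAt_totalSqAmp {γ : ℝ → State N} {s : Set ℝ} (h : W.IsSolutionOn γ s)
    {t : ℝ} (ht : t ∈ s) :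
    HasDerivWithinAt (fun τ => totalSqAmp (γ τ))
      (2 * ∑ k, ((γ t).1 k * W.dv₁ (γ t) k + (γ t).2 k * W.dv₂ (γ t) k)) s t := by
  have hγ := h t ht
  have hx : HasDerivWithinAt (fun τ => (γ τ).1) ((W.field (γ t)).1) s t := by
    simpa using hγ.hasFDerivWithinAt.fst.hasDerivWithinAt
  have hy : HasDerivWithinAt (fun τ => (γ τ).2) ((W.field (γ t)).2) s t := by
    simpa using hγ.hasFDerivWithinAt.snd.hasDerivWithinAt
  have hxk : ∀ k, HasDerivWithinAt (fun τ => (γ τ).1 k) (W.dv₁ (γ t) k) s t := fun k => by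
    simpa [field] using (hasDerivWithinAt_pi.1 hx) k
  have hyk : ∀ k, HasDerivWithinAt (fun τ => (γ τ).2 k) (W.dv₂ (γ t) k) s t := fun k => by
    simpa [field] using (hasDerivWithinAt_pi.1 hy) k
  have hk : ∀ k ∈ (univ : Finset (Fin N)), HasDerivWithinAt (fun τ => sqAmp (γ τ) k)
      (2 * ((γ t).1 k * W.dv₁ (γ t) k + (γ t).2 k * W.dv₂ (γ t) k)) s t := by
    intro k _
    have h1 := (hxk k).mul (hxk k)
    have h2 := (hyk k).mul (hyk k)
    have h12 := h1.add h2
    have he : W.dv₁ (γ t) k * (γ t).1 k + (γ t).1 k * W.dv₁ (γ t) k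
        + (W.dv₂ (γ t) k * (γ t).2 k + (γ t).2 k * W.dv₂ (γ t) k)
        = 2 * ((γ t).1 k * W.dv₁ (γ t) k + (γ t).2 k * W.dv₂ (γ t) k) := by ring
    rw [he] at h12
    have hf : (fun τ => sqAmp (γ τ) k) = fun τ => (γ τ).1 k * (γ τ).1 k + (γ τ).2 k * (γ τ).2 k := by
      funext τ; simp only [sqAmp]; ring
    rw [hf]
    exact h12
  have := HasDerivWithinAt.fun_sum hk
  rw [← mul_sum] at this
  simpa [totalSqAmp] using this

/-- **Global amplitude bound (dVOC network reduced model, every `N ≥ 1`, every initial state).** For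
`η > 0`, `η_a > 0`, all `v_k* ≠ 0`, along every solution of `d/dt v̂ = f^s_v̂(v̂)` on `[0, ∞)`:
`Σ_k ‖v̂_k(t)‖² ≤ L + (Σ_k ‖v̂_k(0)‖² − L) · e^{−2 η a t}` with `L = aS/η_a` (`ampBound`), `a = growthRate`.
MODELLED: [cite: SuboticEtAl2021, eq. (ss.f.vhat)] (MV-6O); crude constants; no synchronisation claim. -/
theorem totalSqAmp_le [NeZero N] (hη : 0 < W.η) (hηa : 0 < W.ηa) (hv : ∀ k, W.vref k ≠ 0)
    {γ : ℝ → State N} (h : W.IsSolutionOn γ (Ici 0)) {t : ℝ} (ht : 0 ≤ t) :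
    totalSqAmp (γ t) - W.ampBound
      ≤ (totalSqAmp (γ 0) - W.ampBound) * exp (-(2 * W.η * W.growthRate) * t) := by
  set L := W.ampBound with hL
  set c := 2 * W.η * W.growthRate with hc
  set g : ℝ → ℝ := fun τ => (totalSqAmp (γ τ) - L) * exp (c * τ) with hg
  have hderiv : ∀ τ ∈ Ici (0:ℝ), HasDerivWithinAt g
      ((2 * ∑ k, ((γ τ).1 k * W.dv₁ (γ τ) k + (γ τ).2 k * W.dv₂ (γ τ) k)
        + c * (totalSqAmp (γ τ) - L)) * exp (c * τ)) (Ici 0) τ := by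
    intro τ hτ
    have h1 := (hasDerivWithinAt_totalSqAmp h hτ).sub_const L
    have h2 : HasDerivWithinAt (fun s => exp (c * s)) (exp (c * τ) * (c * 1)) (Ici 0) τ :=
      (((hasDerivWithinAt_id τ _).const_mul c).exp)
    have h12 := h1.mul h2
    have he : (2 * ∑ k, ((γ τ).1 k * W.dv₁ (γ τ) k + (γ τ).2 k * W.dv₂ (γ τ) k)) * exp (c * τ)
        + (totalSqAmp (γ τ) - L) * (exp (c * τ) * (c * 1))
        = (2 * ∑ k, ((γ τ).1 k * W.dv₁ (γ τ) k + (γ τ).2 k * W.dv₂ (γ τ) k)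
          + c * (totalSqAmp (γ τ) - L)) * exp (c * τ) := by ring
    rw [he] at h12
    exact h12
  have hanti : AntitoneOn g (Ici 0) := by
    refine antitoneOn_of_hasDerivWithinAt_nonpos (convex_Ici 0)
      (f' := fun τ => (2 * ∑ k, ((γ τ).1 k * W.dv₁ (γ τ) k + (γ τ).2 k * W.dv₂ (γ τ) k)
        + c * (totalSqAmp (γ τ) - L)) * exp (c * τ))
      (fun τ hτ => (hderiv τ hτ).continuousWithinAt) (fun τ hτ => ?_) (fun τ hτ => ?_)
    · rw [interior_Ici] at hτ ⊢
      exact (hderiv τ (mem_Ici.2 (le_of_lt hτ))).mono Ioi_subset_Ici_self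
    · have hb := W.half_deriv_totalSqAmp_le hη hηa hv (γ τ)
      have hnum : 2 * ∑ k, ((γ τ).1 k * W.dv₁ (γ τ) k + (γ τ).2 k * W.dv₂ (γ τ) k)
          + c * (totalSqAmp (γ τ) - L) ≤ 0 := by
        rw [hc, hL]; linarith
      exact mul_nonpos_of_nonpos_of_nonneg hnum (exp_pos _).le
  have hg0 := hanti (mem_Ici.2 le_rfl) (mem_Ici.2 ht) ht
  simp only [hg, mul_zero, exp_zero, mul_one] at hg0
  have hpos' : 0 < exp (-c * t) := exp_pos _
  have hmul := mul_le_mul_of_nonneg_right hg0 hpos'.le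
  have hexp' : exp (c * t) * exp (-c * t) = 1 := by rw [← exp_add]; simp [neg_mul]
  calc totalSqAmp (γ t) - L = (totalSqAmp (γ t) - L) * (exp (c * t) * exp (-c * t)) := by
        rw [hexp', mul_one]
    _ = (totalSqAmp (γ t) - L) * exp (c * t) * exp (-c * t) := by ring
    _ ≤ (totalSqAmp (γ 0) - L) * exp (-c * t) := hmul

/-- **The amplitude ball is positively invariant.** If `Σ_k ‖v̂_k(0)‖² ≤ L` then
`Σ_k ‖v̂_k(t)‖² ≤ L` for all `t ≥ 0`. -/
theorem totalSqAmp_le_of_le [NeZero N] (hη : 0 < W.η) (hηa : 0 < W.ηa) (hv : ∀ k, W.vref k ≠ 0)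
    {γ : ℝ → State N} (h : W.IsSolutionOn γ (Ici 0)) (h0 : totalSqAmp (γ 0) ≤ W.ampBound)
    {t : ℝ} (ht : 0 ≤ t) : totalSqAmp (γ t) ≤ W.ampBound := by
  have hb := totalSqAmp_le hη hηa hv h ht
  have he : 0 < exp (-(2 * W.η * W.growthRate) * t) := exp_pos _
  nlinarith

/-- **Eventual amplitude bound.** For every `ε > 0`, eventually `Σ_k ‖v̂_k(t)‖² ≤ L + ε`; in
particular every converter amplitude satisfies `‖v̂_k(t)‖² ≤ L + ε` eventually. -/
theorem eventually_totalSqAmp_le [NeZero N] (hη : 0 < W.η) (hηa : 0 < W.ηa)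
    (hv : ∀ k, W.vref k ≠ 0) {γ : ℝ → State N} (h : W.IsSolutionOn γ (Ici 0)) {ε : ℝ}
    (hε : 0 < ε) : ∀ᶠ t in atTop, totalSqAmp (γ t) ≤ W.ampBound + ε := by
  have ha : 0 < 2 * W.η * W.growthRate := by
    have := W.ηa_le_growthRate; nlinarith
  have hdec : Tendsto (fun t : ℝ => (totalSqAmp (γ 0) - W.ampBound)
      * exp (-(2 * W.η * W.growthRate) * t)) atTop (𝓝 0) := by
    have h1 : Tendsto (fun t : ℝ => -(2 * W.η * W.growthRate) * t) atTop atBot := by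
      refine (tendsto_neg_atTop_atBot.comp (tendsto_id.const_mul_atTop ha)).congr fun t => ?_
      simp [neg_mul]
    simpa using (tendsto_exp_atBot.comp h1).const_mul (totalSqAmp (γ 0) - W.ampBound)
  filter_upwards [hdec.eventually (eventually_le_nhds hε), eventually_ge_atTop (0:ℝ)] with t ht ht0
  have := totalSqAmp_le hη hηa hv h ht0
  linarith

end Summit.Ventures.GridStability.Models.InverterDVOC.DvocNetwork

end
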